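import Summits.QuantumFields.BalabanUV.T4Continuum.Support.B13ReadingsAvgTowerDirect

/-!
# B13ReadingsAvgTowerFactor — row NE5, located junction J-avg-reg (GAPS § G-ne5p1-Javg-reg), file 3 of 4: THE FACTORISATION STEP for
# k-UNIFORM levelwise regularity of an averaging tower — carry per level the STRAIGHT tower `S` (products of the fine straight parts, no
# corrections; for Bałaban's objects the axial-decimation tower `AveragingRT.axial`) and the distance letter `‖R − S‖ ≤ ρ∕(lev L k)²`; one step
# down: `ρ_k ≤ e^{α∕ℓ_k}(κ + ρ_{k+1}∕L)` (GEOMETRIC — the finer corrections are suppressed by `1∕L`), the straight tower's size and Lipschitz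
# letters propagate with factors `1 + O(1∕ℓ_k)` and NO additive term, and the transporter's levelwise letters follow from its straight part by
# triangle inequalities — the road to (ℓ1) that the one-step (α, β)-iteration of file 2 cannot take (it re-pays `2κ` per level)

Cell `pub-balaban`, unit `b2b-balaban-t4-ne5-p1` (row NE5 OWNER, gen 39; owner item «g39-b», sequel of g39-a = files 1–2 `B13ReadingsLineProducts` ∕
`B13ReadingsAvgTowerDirect`; `HOME/CLAIMS.log` NOTE l.22995, INTENT l.23219; T4-DAG §8 Q49 (dagwriter l.23035: «GO as an NE5-lineage ABSTRACT Support
module»); substrate ruling (ο10) l.23046: W-25 = L-E19 consumes these names).  Summits-side NEW WORK under the LEAN PLACEMENT RULE: [folklore]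
normed-algebra estimates + lattice bookkeeping on the ABSTRACT towers of rows NE2 ∕ B5; 0 `def`, no `Prop`-valued fact minted, nothing printed
asserted, no citation tag.  HONEST FRAMING: rung (B)+1 of the FINITE-VOLUME T⁴ programme — NOT infinite volume, NOT a mass gap, NOT the Clay
problem, NOT a proof of NE5 (NOT PRINTED; GAPS G-t4-U3-1), NOT a proof of NE2, NOT a statement about Bałaban's block average (the structures are
DISPLAYED hypotheses; their instances for `towerOf ∘ blockAvg ℰ` ∕ `towerOf ∘ axial` and the correction letter `κ` — [Balaban1987RG1] (0.4),
[Balaban1985Averaging] Props 1–2 KIND — are the substrate's W-25 = L-E19).  HONEST DEPENDENCY (cell, verbatim): continuum YM on T⁴ ⇐ BetaPertH ∧ nine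
spine estimates (0/9 proved); BetaPertH ⇐ (D1) ∧ (D4) ∧ CAP+tail; G-an2-4 gates asym, D1 and NE2/3/4.

WHAT.
* §1 (pure, `[NormedRing A] [NormedAlgebra ℂ A]`): `norm_corrLine_sub_lprod_le` — `‖C·Π f_t − Π g_t‖ ≤ e^{α∕ℓ}(κc + n·ρ′)` when `‖f_t − g_t‖ ≤ ρ′`,
  scaled sizes `≤ α`, `‖C − 1‖ ≤ κc`; `norm_scaled_lprod_le` (straight size step, `C = 1`), `norm_scaled_lprod_sub_lprod_le` (straight two-line
  step); `norm_scaled_sub_one_le_of_near` ∕ `norm_scaled_sub_le_of_near` (transporter letters from the straight part + distance); the two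
  uniformity lemmas for the recursions they generate: `geom_recursion_uniform` (`ρ_j ≤ a + qρ_{j+1}`, `q < 1`, `ρ_N = 0` ⟹ `ρ_j ≤ a∕(1−q)`) and
  `mult_recursion_uniform` (`b_j ≤ (1 + c_j)b_{j+1}`, `Σ c_j ≤ s` ⟹ `b_j ≤ e^s b_N`).
* §2 (tower currency, NE2's convention: level-(k+1) sites in `Tor (fine (L * lev L k) M)`): at one coarse index `i`, direction `μ`, from the
  level-(k+1) letters along the line and the two structures — `dist_straight_of_step` (`‖R k μ i − S k μ i‖ ≤ e^{α∕ℓ_k}(κ + ρ′∕L)∕ℓ_k²`),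
  `straight_size_of_step` (`≤ α_S + α_S²∕ℓ_k`), `straight_lipschitz_of_step` (`≤ e^{α_S∕ℓ_k}β_S∕ℓ_k`, lines `L` fine `ν`-steps apart),
  `size_of_straight`, `lipschitz_of_straight` (`+ ρ∕ℓ_k`, `+ 2ρ∕ℓ_k`).
File 4 `B13ReadingsAvgTowerUniform` runs the induction to the END: `RegularTransporters L M R (2α′ + 8κ) (2β′ + 16κ)` from the finest letters of `S`,
the structures below the finest level and `κ`, under `α′ ≤ 1∕16`, `κ ≤ 1∕64`, `2 ≤ L`.
0 sorry; axioms ⊆ {propext, Classical.choice, Quot.sound}.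
-/

noncomputable section

open scoped BigOperators Matrix Matrix.Norms.L2Operator

namespace Summit.QuantumFields.BalabanUV.T4Continuum.B13ReadingsAvgTowerFactor

open Summit.QuantumFields.BalabanUV.T4Continuum.B13ReadingsLineProducts

/-! ## §1 Pure step lemmas (normed algebra): distance to the straight product, and the straight product's own size ∕ two-line bounds -/

section Pure

variable {A : Type*} [NormedRing A] [NormedAlgebra ℂ A]

/-- [folklore] **ρ-STEP**: coarse transporter `C·Π_{t<n} f_t` vs the straight product `Π_{t<n} g_t` of the fine STRAIGHT parts, when each fine
transporter is within `ρ′` of its straight part (`‖f_t − g_t‖ ≤ ρ′`), all factors have scaled size `≤ α` (scale `nℓ`) and `‖C − 1‖ ≤ κc`: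
`‖C·Π f_t − Π g_t‖ ≤ e^{α∕ℓ}·(κc + n·ρ′)`. -/
theorem norm_corrLine_sub_lprod_le {ℓ n : ℕ} (hℓ : 0 < ℓ) (hn : 0 < n) {f g : ℕ → A} {α κc ρ' : ℝ}
    (hαf : ∀ t < n, ‖((n * ℓ : ℕ) : ℂ) • (f t - 1)‖ ≤ α) (hαg : ∀ t < n, ‖((n * ℓ : ℕ) : ℂ) • (g t - 1)‖ ≤ α)
    (hρ : ∀ t < n, ‖f t - g t‖ ≤ ρ') {C : A} (hC : ‖C - 1‖ ≤ κc) :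
    ‖C * lprod f n - lprod g n‖ ≤ Real.exp (α / ℓ) * (κc + n * ρ') := by
  have hℓr : (0 : ℝ) < ℓ := by exact_mod_cast hℓ
  have hnℓ : 0 < n * ℓ := Nat.mul_pos hn hℓ
  have hα0 : 0 ≤ α := (norm_nonneg _).trans (hαf 0 hn)
  have hκc : 0 ≤ κc := (norm_nonneg _).trans hC
  have hρ0 : 0 ≤ ρ' := (norm_nonneg _).trans (hρ 0 hn)
  set e := α / ((n * ℓ : ℕ) : ℝ) with he_def
  have hef : ∀ t < n, ‖f t - 1‖ ≤ e := fun t ht => norm_sub_one_le_of_scaled hnℓ (hαf t ht)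
  have heg : ∀ t < n, ‖g t - 1‖ ≤ e := fun t ht => norm_sub_one_le_of_scaled hnℓ (hαg t ht)
  have he0 : 0 ≤ e := by positivity
  have hpow : (1 + e) ^ n ≤ Real.exp (α / ℓ) := by
    calc (1 + e) ^ n ≤ (Real.exp e) ^ n := pow_le_pow_left₀ (by positivity) (by rw [add_comm]; exact Real.add_one_le_exp e) n
      _ = Real.exp (n * e) := by rw [← Real.exp_nat_mul]
      _ = Real.exp (α / ℓ) := by congr 1; rw [he_def, Nat.cast_mul]; field_simp
  have hPf : ‖lprod f n - 1‖ + 1 ≤ Real.exp (α / ℓ) := by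
    have h1 := norm_lprod_sub_one_le f n
    have h2 : ∏ t ∈ Finset.range n, (1 + ‖f t - 1‖) ≤ (1 + e) ^ n := by
      calc ∏ t ∈ Finset.range n, (1 + ‖f t - 1‖) ≤ ∏ _t ∈ Finset.range n, (1 + e) :=
            Finset.prod_le_prod (fun t _ => by positivity) (fun t ht => add_le_add le_rfl (hef t (Finset.mem_range.1 ht)))
        _ = (1 + e) ^ n := by rw [Finset.prod_const, Finset.card_range]
    linarith
  have hPP : ‖lprod f n - lprod g n‖ ≤ Real.exp (α / ℓ) * (n * ρ') := by
    calc ‖lprod f n - lprod g n‖ ≤ (1 + e) ^ n * ∑ t ∈ Finset.range n, ‖f t - g t‖ := norm_lprod_sub_lprod_le hef heg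
      _ ≤ Real.exp (α / ℓ) * ∑ _t ∈ Finset.range n, ρ' :=
          mul_le_mul hpow (Finset.sum_le_sum fun t ht => hρ t (Finset.mem_range.1 ht)) (Finset.sum_nonneg fun _ _ => norm_nonneg _)
            (by positivity)
      _ = Real.exp (α / ℓ) * (n * ρ') := by rw [Finset.sum_const, Finset.card_range, nsmul_eq_mul]
  have hring : C * lprod f n - lprod g n = ((C - 1) * (lprod f n - 1) + (C - 1)) + (lprod f n - lprod g n) := by noncomm_ring
  rw [hring]
  calc ‖((C - 1) * (lprod f n - 1) + (C - 1)) + (lprod f n - lprod g n)‖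
      ≤ (‖C - 1‖ * ‖lprod f n - 1‖ + ‖C - 1‖) + ‖lprod f n - lprod g n‖ :=
        (norm_add_le _ _).trans (add_le_add ((norm_add_le _ _).trans (add_le_add (norm_mul_le _ _) le_rfl)) le_rfl)
    _ = ‖C - 1‖ * (‖lprod f n - 1‖ + 1) + ‖lprod f n - lprod g n‖ := by ring
    _ ≤ κc * Real.exp (α / ℓ) + Real.exp (α / ℓ) * (n * ρ') := add_le_add (mul_le_mul hC hPf (by positivity) hκc) hPP
    _ = Real.exp (α / ℓ) * (κc + n * ρ') := by ring

/-- [folklore] **STRAIGHT SIZE STEP**: the straight product of `n` factors of scaled size `≤ α ≤ ℓ` has scaled size `≤ α + α²∕ℓ` at scale `ℓ`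
(`norm_scaled_corrLine_le` with `C = 1`). -/
theorem norm_scaled_lprod_le {ℓ n : ℕ} (hℓ : 0 < ℓ) (hn : 0 < n) {g : ℕ → A} {α : ℝ}
    (hα : ∀ t < n, ‖((n * ℓ : ℕ) : ℂ) • (g t - 1)‖ ≤ α) (hαℓ : α ≤ ℓ) :
    ‖((ℓ : ℕ) : ℂ) • (lprod g n - 1)‖ ≤ α + α ^ 2 / ℓ := by
  have h := norm_scaled_corrLine_le (A := A) hℓ hn hα hαℓ (C := 1) (κc := 0) (by rw [sub_self, norm_zero])
  rw [one_mul] at h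
  simpa using h

/-- [folklore] **STRAIGHT TWO-LINE STEP**: two straight products whose factors are pairwise within `δ` (scaled sizes `≤ α`):
`‖ℓ•(Π g′_t − Π g_t)‖ ≤ ℓ·e^{α∕ℓ}·n·δ` (`norm_scaled_corrLine_sub_corrLine_le` with `C = C′ = 1`). -/
theorem norm_scaled_lprod_sub_lprod_le {ℓ n : ℕ} (hℓ : 0 < ℓ) (hn : 0 < n) {g g' : ℕ → A} {α δ : ℝ}
    (hα : ∀ t < n, ‖((n * ℓ : ℕ) : ℂ) • (g t - 1)‖ ≤ α) (hα' : ∀ t < n, ‖((n * ℓ : ℕ) : ℂ) • (g' t - 1)‖ ≤ α)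
    (hδ : ∀ t < n, ‖g t - g' t‖ ≤ δ) :
    ‖((ℓ : ℕ) : ℂ) • (lprod g' n - lprod g n)‖ ≤ ℓ * Real.exp (α / ℓ) * (n * δ) := by
  have h := norm_scaled_corrLine_sub_corrLine_le (A := A) hℓ hn hα hα' hδ (C := 1) (C' := 1) (κc := 0) (κΔ := 0)
    (by rw [sub_self, norm_zero]) (by rw [sub_self, norm_zero])
  rw [one_mul, one_mul] at h
  refine h.trans (le_of_eq ?_)
  ring

/-- [folklore] **FROM THE STRAIGHT PART TO THE TRANSPORTER, SIZE**: `‖ℓ•(R − 1)‖ ≤ ‖ℓ•(S − 1)‖ + ℓ·‖R − S‖`. -/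
theorem norm_scaled_sub_one_le_of_near {ℓ : ℕ} (R S : A) :
    ‖((ℓ : ℕ) : ℂ) • (R - 1)‖ ≤ ‖((ℓ : ℕ) : ℂ) • (S - 1)‖ + ℓ * ‖R - S‖ := by
  have e : ((ℓ : ℕ) : ℂ) • (R - 1) = ((ℓ : ℕ) : ℂ) • (S - 1) + ((ℓ : ℕ) : ℂ) • (R - S) := by rw [← smul_add]; congr 1; abel
  rw [e]
  refine (norm_add_le _ _).trans (add_le_add le_rfl ?_)
  rw [norm_smul, Complex.norm_natCast]

/-- [folklore] **FROM THE STRAIGHT PART TO THE TRANSPORTER, LIPSCHITZ**: `‖ℓ•(R′ − R)‖ ≤ ‖ℓ•(S′ − S)‖ + ℓ·(‖R′ − S′‖ + ‖R − S‖)`. -/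
theorem norm_scaled_sub_le_of_near {ℓ : ℕ} (R R' S S' : A) :
    ‖((ℓ : ℕ) : ℂ) • (R' - R)‖ ≤ ‖((ℓ : ℕ) : ℂ) • (S' - S)‖ + ℓ * (‖R' - S'‖ + ‖R - S‖) := by
  have e : ((ℓ : ℕ) : ℂ) • (R' - R) = ((ℓ : ℕ) : ℂ) • (S' - S) + ((ℓ : ℕ) : ℂ) • ((R' - S') - (R - S)) := by
    rw [← smul_add]; congr 1; abel
  rw [e]
  refine (norm_add_le _ _).trans (add_le_add le_rfl ?_)
  rw [norm_smul, Complex.norm_natCast]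
  exact mul_le_mul_of_nonneg_left (norm_sub_le _ _) (Nat.cast_nonneg _)

/-- [folklore] **THE GEOMETRIC RECURSION IS UNIFORM**: if `0 ≤ ρ_j`, `ρ_N = 0` and `ρ_j ≤ a + q·ρ_{j+1}` for `j < N` with `0 ≤ a`, `0 ≤ q < 1`,
then `ρ_j ≤ a ∕ (1 − q)` for all `j ≤ N`. -/
theorem geom_recursion_uniform {ρ : ℕ → ℝ} {a q : ℝ} {N : ℕ} (ha : 0 ≤ a) (hq0 : 0 ≤ q) (hq1 : q < 1) (hN : ρ N = 0)
    (hstep : ∀ j < N, ρ j ≤ a + q * ρ (j + 1)) : ∀ j ≤ N, ρ j ≤ a / (1 - q) := by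
  have hq' : 0 < 1 - q := by linarith
  have hfix : a + q * (a / (1 - q)) = a / (1 - q) := by field_simp; ring
  have hbound : 0 ≤ a / (1 - q) := div_nonneg ha hq'.le
  -- downward induction on `N - j`
  suffices h : ∀ m j, j + m = N → ρ j ≤ a / (1 - q) by
    intro j hj; exact h (N - j) j (by omega)
  intro m
  induction m with
  | zero => intro j hj; rw [add_zero] at hj; rw [hj, hN]; exact hbound
  | succ m ih =>
    intro j hj
    have hjN : j < N := by omega
    calc ρ j ≤ a + q * ρ (j + 1) := hstep j hjN
      _ ≤ a + q * (a / (1 - q)) := add_le_add le_rfl (mul_le_mul_of_nonneg_left (ih (j + 1) (by omega)) hq0)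
      _ = a / (1 - q) := hfix

/-- [folklore] **THE MULTIPLICATIVE RECURSION IS UNIFORM**: if `0 ≤ b_j`, `b_j ≤ (1 + c_j)·b_{j+1}` for `j < N` with `0 ≤ c_j` and
`Σ_{j<N} c_j ≤ s`, then `b_j ≤ e^s·b_N` for all `j ≤ N`. -/
theorem mult_recursion_uniform {b c : ℕ → ℝ} {s : ℝ} {N : ℕ} (hb : ∀ j, 0 ≤ b j) (hc : ∀ j, 0 ≤ c j)
    (hs : ∑ j ∈ Finset.range N, c j ≤ s) (hstep : ∀ j < N, b j ≤ (1 + c j) * b (j + 1)) :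
    ∀ j ≤ N, b j ≤ Real.exp s * b N := by
  -- `b j ≤ exp (Σ_{i ∈ [j, N)} c i) · b N` by downward induction
  suffices h : ∀ m j, j + m = N → b j ≤ Real.exp (∑ i ∈ Finset.Ico j N, c i) * b N by
    intro j hj
    refine (h (N - j) j (by omega)).trans (mul_le_mul_of_nonneg_right (Real.exp_le_exp.2 ?_) (hb N))
    calc ∑ i ∈ Finset.Ico j N, c i ≤ ∑ i ∈ Finset.range N, c i :=
          Finset.sum_le_sum_of_subset_of_nonneg (fun i hi => by
            rw [Finset.mem_range]; exact (Finset.mem_Ico.1 hi).2) (fun i _ _ => hc i)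
      _ ≤ s := hs
  intro m
  induction m with
  | zero => intro j hj; rw [add_zero] at hj; subst hj; simp
  | succ m ih =>
    intro j hj
    have hjN : j < N := by omega
    have hsplit : ∑ i ∈ Finset.Ico j N, c i = c j + ∑ i ∈ Finset.Ico (j + 1) N, c i := by
      rw [Finset.sum_eq_sum_Ico_succ_bot hjN]
    calc b j ≤ (1 + c j) * b (j + 1) := hstep j hjN
      _ ≤ Real.exp (c j) * (Real.exp (∑ i ∈ Finset.Ico (j + 1) N, c i) * b N) :=
          mul_le_mul (by rw [add_comm]; exact Real.add_one_le_exp _) (ih (j + 1) (by omega)) (hb _) (Real.exp_pos _).le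
      _ = Real.exp (∑ i ∈ Finset.Ico j N, c i) * b N := by rw [hsplit, Real.exp_add, mul_assoc]

end Pure

/-! ## §2 In the tower currency: one step of the factorisation induction at a coarse index -/

section Tower

open Literature.MathematicalPhysics.QuantumFieldTheory.Balaban1983to89.B5Prop11Plancherel (fine Tor)
open Literature.MathematicalPhysics.QuantumFieldTheory.Balaban1983to89.B5Block118 (tstep)
open Literature.MathematicalPhysics.QuantumFieldTheory.Balaban1983to89.B5G183RateUnitTower (lev lev_neZero)
open Summit.QuantumFields.BalabanUV.T4Continuum.BalabanAveragedTowerUnit (idx one_le_lev' lev_succ')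
open Summit.QuantumFields.BalabanUV.T4Continuum.BlockPairingGeometry (tau)
open Summit.QuantumFields.BalabanUV.T4Continuum.NE2FromNE3BavgBridge (norm_sub_tstep_le)

variable {d : ℕ} (L : ℕ) [NeZero L] (M : Fin d → ℕ) [hM : ∀ μ, NeZero (M μ)]
variable {o : Type*} [Fintype o] [DecidableEq o]
variable {R S : (k : ℕ) → Fin d → (idx L M k → Matrix o o ℂ)}

omit hM in
/-- [folklore] arithmetic: `e^{α∕ℓ}(κ∕ℓ² + L·(ρ′∕ℓ′∕ℓ′)) = e^{α∕ℓ}(κ + ρ′∕L)∕ℓ²` with `ℓ′ = Lℓ`. -/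
theorem dist_term_eq {α κ ρ' : ℝ} (hL : 0 < L) (k : ℕ) :
    Real.exp (α / (lev L k : ℕ)) * (κ / ((lev L k : ℕ) : ℝ) ^ 2 + L * (ρ' / ((L * lev L k : ℕ) : ℝ) / ((L * lev L k : ℕ) : ℝ)))
      = Real.exp (α / (lev L k : ℕ)) * (κ + ρ' / L) / ((lev L k : ℕ) : ℝ) ^ 2 := by
  have hℓ : (0 : ℝ) < (lev L k : ℕ) := by exact_mod_cast one_le_lev' L k
  have hLr : (0 : ℝ) < L := by exact_mod_cast hL
  rw [Nat.cast_mul]; field_simp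

omit hM in
/-- [folklore] **ρ-STEP AT A COARSE INDEX** (the heart of the factorisation induction).  Level-`(k+1)` letters: scaled sizes `≤ α` of the
transporters `R (k+1) μ` AND of the straight parts `S (k+1) μ` along the line, distance `‖R (k+1) μ x − S (k+1) μ x‖ ≤ ρ′∕ℓ′²`; structure at
`i`: `R k μ i = C · Π_t R (k+1) μ (line t)` with `‖C − 1‖ ≤ κ∕ℓ²` (the averaging step) and `S k μ i = Π_t S (k+1) μ (line t)` (the straight
step).  Then `‖R k μ i − S k μ i‖ ≤ e^{α∕ℓ}·(κ + ρ′∕L)∕ℓ²` — the finer levels' corrections are SUPPRESSED BY `1∕L`: iterating,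
`ρ_k ≤ e^{α∕ℓ_k}(κ + ρ_{k+1}∕L)` stays bounded (`geom_recursion_uniform`). -/
theorem dist_straight_of_step {k : ℕ} {μ : Fin d} {i : idx L M k} {C : Matrix o o ℂ} {s : Tor (fine (L * lev L k) M)} {α κ ρ' : ℝ}
    (hRsize : ∀ t < L, ‖((L * lev L k : ℕ) : ℂ) • (R (k + 1) μ (s + tstep (fine (L * lev L k) M) μ t, i.2) - 1)‖ ≤ α)
    (hSsize : ∀ t < L, ‖((L * lev L k : ℕ) : ℂ) • (S (k + 1) μ (s + tstep (fine (L * lev L k) M) μ t, i.2) - 1)‖ ≤ α)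
    (hρ : ∀ t < L, ‖R (k + 1) μ (s + tstep (fine (L * lev L k) M) μ t, i.2) - S (k + 1) μ (s + tstep (fine (L * lev L k) M) μ t, i.2)‖
      ≤ ρ' / ((L * lev L k : ℕ) : ℝ) / ((L * lev L k : ℕ) : ℝ))
    (hstructR : R k μ i = C * lprod (fun t => R (k + 1) μ (s + tstep (fine (L * lev L k) M) μ t, i.2)) L)
    (hC : ‖C - 1‖ ≤ κ / ((lev L k : ℕ) : ℝ) ^ 2)
    (hstructS : S k μ i = lprod (fun t => S (k + 1) μ (s + tstep (fine (L * lev L k) M) μ t, i.2)) L) :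
    ‖R k μ i - S k μ i‖ ≤ Real.exp (α / (lev L k : ℕ)) * (κ + ρ' / L) / ((lev L k : ℕ) : ℝ) ^ 2 := by
  have hL : 0 < L := Nat.pos_of_ne_zero (NeZero.ne L)
  have h := norm_corrLine_sub_lprod_le (A := Matrix o o ℂ) (one_le_lev' L k) hL hRsize hSsize hρ hC
  rw [hstructR, hstructS, ← dist_term_eq L hL k]
  exact h

omit hM in
/-- [folklore] **STRAIGHT SIZE AT LEVEL `k`**: `‖ℓ•(S k μ i − 1)‖ ≤ α_S + α_S²∕ℓ` from the level-`(k+1)` straight sizes `≤ α_S ≤ ℓ` and the straight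
structure. -/
theorem straight_size_of_step {k : ℕ} {μ : Fin d} {i : idx L M k} {s : Tor (fine (L * lev L k) M)} {αS : ℝ}
    (hSsize : ∀ t < L, ‖((L * lev L k : ℕ) : ℂ) • (S (k + 1) μ (s + tstep (fine (L * lev L k) M) μ t, i.2) - 1)‖ ≤ αS)
    (hαℓ : αS ≤ (lev L k : ℕ))
    (hstructS : S k μ i = lprod (fun t => S (k + 1) μ (s + tstep (fine (L * lev L k) M) μ t, i.2)) L) :
    ‖((lev L k : ℕ) : ℂ) • (S k μ i - 1)‖ ≤ αS + αS ^ 2 / (lev L k : ℕ) := by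
  have hL : 0 < L := Nat.pos_of_ne_zero (NeZero.ne L)
  rw [hstructS]
  exact norm_scaled_lprod_le (A := Matrix o o ℂ) (one_le_lev' L k) hL hSsize hαℓ

omit hM in
/-- [folklore] **STRAIGHT LIPSCHITZ AT LEVEL `k`**: from the level-`(k+1)` straight sizes `≤ α_S` and the plain Lipschitz bound
`‖S (k+1) μ (x + e_ν) − S (k+1) μ x‖ ≤ β_S∕ℓ′∕ℓ′`, with the straight structure at `i` and at `i + e_ν` (lines `L` fine `ν`-steps apart):
`‖ℓ•(S k μ (i + e_ν) − S k μ i)‖ ≤ e^{α_S∕ℓ}·β_S∕ℓ` — a factor `1 + O(1∕ℓ)` per level and NO additive term (`mult_recursion_uniform`). -/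
theorem straight_lipschitz_of_step {k : ℕ} {μ ν : Fin d} {i : idx L M k} {s : Tor (fine (L * lev L k) M)} {αS βS : ℝ}
    (hSsize : ∀ x : Tor (fine (L * lev L k) M) × Fin d, ‖((L * lev L k : ℕ) : ℂ) • (S (k + 1) μ x - 1)‖ ≤ αS)
    (hSlip : ∀ (ν' : Fin d) (x : Tor (fine (L * lev L k) M) × Fin d),
      ‖S (k + 1) μ (tau (fine (L * lev L k) M) ν' x) - S (k + 1) μ x‖ ≤ βS / ((L * lev L k : ℕ) : ℝ) / ((L * lev L k : ℕ) : ℝ))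
    (hstructS : S k μ i = lprod (fun t => S (k + 1) μ (s + tstep (fine (L * lev L k) M) μ t, i.2)) L)
    (hstructS' : S k μ (tau (fine (lev L k) M) ν i)
      = lprod (fun t => S (k + 1) μ (s + tstep (fine (L * lev L k) M) ν L + tstep (fine (L * lev L k) M) μ t, i.2)) L) :
    ‖((lev L k : ℕ) : ℂ) • (S k μ (tau (fine (lev L k) M) ν i) - S k μ i)‖ ≤ Real.exp (αS / (lev L k : ℕ)) * βS / (lev L k : ℕ) := by
  have hL : 0 < L := Nat.pos_of_ne_zero (NeZero.ne L)
  have hLr : (0 : ℝ) < L := by exact_mod_cast hL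
  have hℓ : (0 : ℝ) < (lev L k : ℕ) := by exact_mod_cast one_le_lev' L k
  have hδ : ∀ t < L, ‖S (k + 1) μ (s + tstep (fine (L * lev L k) M) μ t, i.2)
      - S (k + 1) μ (s + tstep (fine (L * lev L k) M) ν L + tstep (fine (L * lev L k) M) μ t, i.2)‖
      ≤ L * (βS / ((L * lev L k : ℕ) : ℝ) / ((L * lev L k : ℕ) : ℝ)) := by
    intro t _
    rw [add_right_comm s, norm_sub_rev]
    exact norm_sub_tstep_le (S (k + 1) μ) hSlip _ i.2 ν L
  have h := norm_scaled_lprod_sub_lprod_le (A := Matrix o o ℂ) (one_le_lev' L k) hL (fun t _ => hSsize _) (fun t _ => hSsize _) hδ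
  rw [hstructS, hstructS']
  refine h.trans (le_of_eq ?_)
  rw [Nat.cast_mul]; field_simp

omit hM in
/-- [folklore] **THE TRANSPORTER's SIZE AT LEVEL `k` FROM ITS STRAIGHT PART**: `‖ℓ•(R k μ i − 1)‖ ≤ ‖ℓ•(S k μ i − 1)‖ + ρ∕ℓ` when
`‖R k μ i − S k μ i‖ ≤ ρ∕ℓ²`. -/
theorem size_of_straight {k : ℕ} {μ : Fin d} {i : idx L M k} {ρ : ℝ} (hρ : ‖R k μ i - S k μ i‖ ≤ ρ / ((lev L k : ℕ) : ℝ) ^ 2) :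
    ‖((lev L k : ℕ) : ℂ) • (R k μ i - 1)‖ ≤ ‖((lev L k : ℕ) : ℂ) • (S k μ i - 1)‖ + ρ / (lev L k : ℕ) := by
  have hℓ : (0 : ℝ) < (lev L k : ℕ) := by exact_mod_cast one_le_lev' L k
  refine (norm_scaled_sub_one_le_of_near (A := Matrix o o ℂ) (R k μ i) (S k μ i)).trans (add_le_add le_rfl ?_)
  calc ((lev L k : ℕ) : ℝ) * ‖R k μ i - S k μ i‖ ≤ (lev L k : ℕ) * (ρ / ((lev L k : ℕ) : ℝ) ^ 2) :=
        mul_le_mul_of_nonneg_left hρ hℓ.le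
    _ = ρ / (lev L k : ℕ) := by field_simp

omit hM in
/-- [folklore] **THE TRANSPORTER's LIPSCHITZ BOUND AT LEVEL `k` FROM ITS STRAIGHT PART**: `‖ℓ•(R k μ (i+e_ν) − R k μ i)‖ ≤
‖ℓ•(S k μ (i+e_ν) − S k μ i)‖ + 2ρ∕ℓ` — the correction enters ADDITIVELY ONCE, not per level. -/
theorem lipschitz_of_straight {k : ℕ} {μ ν : Fin d} {i : idx L M k} {ρ : ℝ}
    (hρ : ‖R k μ i - S k μ i‖ ≤ ρ / ((lev L k : ℕ) : ℝ) ^ 2)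
    (hρ' : ‖R k μ (tau (fine (lev L k) M) ν i) - S k μ (tau (fine (lev L k) M) ν i)‖ ≤ ρ / ((lev L k : ℕ) : ℝ) ^ 2) :
    ‖((lev L k : ℕ) : ℂ) • (R k μ (tau (fine (lev L k) M) ν i) - R k μ i)‖
      ≤ ‖((lev L k : ℕ) : ℂ) • (S k μ (tau (fine (lev L k) M) ν i) - S k μ i)‖ + 2 * ρ / (lev L k : ℕ) := by
  have hℓ : (0 : ℝ) < (lev L k : ℕ) := by exact_mod_cast one_le_lev' L k
  refine (norm_scaled_sub_le_of_near (A := Matrix o o ℂ) (R k μ i) (R k μ (tau (fine (lev L k) M) ν i)) (S k μ i)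
    (S k μ (tau (fine (lev L k) M) ν i))).trans (add_le_add le_rfl ?_)
  calc ((lev L k : ℕ) : ℝ) * (‖R k μ (tau (fine (lev L k) M) ν i) - S k μ (tau (fine (lev L k) M) ν i)‖ + ‖R k μ i - S k μ i‖)
      ≤ (lev L k : ℕ) * (ρ / ((lev L k : ℕ) : ℝ) ^ 2 + ρ / ((lev L k : ℕ) : ℝ) ^ 2) :=
        mul_le_mul_of_nonneg_left (add_le_add hρ' hρ) hℓ.le
    _ = 2 * ρ / (lev L k : ℕ) := by field_simp; ring

end Tower

end Summit.QuantumFields.BalabanUV.T4Continuum.B13ReadingsAvgTowerFactor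

end
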